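import Summits.CriticalPhenomena.PercolationContinuityZ3.Theorems.PercAnnulusCrossingLandingStarts
import Summits.CriticalPhenomena.PercolationContinuityZ3.Theorems.PercAnnulusCrossingBoxCrossingDefs2
import HarnessLib

/-!
# RSW3 lane: the CONDITIONAL second-moment route — `Q₂ ≥ c` for successful starts gives `CondBlockGluingAt p c`

builds on p205010 (kernel theorem, internal audit signed; external expert review pending)

RSW3 lane (LANE 3 `prim-rsw3`), lead seat, gen 5.  Helper file (`--supports`); no definitions, no named facts, no sorries.
Fourth file of the successful-starts series.  In the geometry of the lane's conditional block gluing (`Crossing.CondBlockGluingAt`,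
census Q18 / PREREG-C1-8: block `P = {0..a}×{0..n}²`, `a ≥ n ≥ 1`, glued through the slab of thickness `n − ⌊n/2⌋` to the union
`X = {0..a+n−⌊n/2⌋}×{0..n}²`), write `B = boxCross ![a,n,n] 0`, `U = boxCross ![a+n−⌊n/2⌋,n,n] 0`, `M` = number of successful
starts on the far face of `P` (landing inside `P`, forward through the slab; `PercAnnulusCrossingLandingStarts`), and
`m = E[M] = Σ_v ℓ_v f_v`, `S = E[M²] = Σ_{v,w} ℓ_{vw} f_{vw}` (exact disjoint-edge products).  Since `{M ≥ 1} ⊆ B`, the census's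
conditional Paley–Zygmund ratio is `Q₂ = E[M ∣ B]²/E[M² ∣ B] = m²/(P(B)·S)`.

* `sum_landing_forward_le_pair_sum` — `m ≤ S` (diagonal terms), so `m > 0 ⇒ S > 0`;
* `mul_real_boxCross_le_union_of_condSecondMoment` — **`m > 0` and `c·P(B)·S ≤ m²` (i.e. `Q₂ ≥ c`) give `c·P_p(B) ≤ P_p(U)`**
  (every `p`, any `a ≤ A`; from `sq_sum_landing_forward_le`: `m² ≤ P(U)·S`);
* `condBlockGluingAt_of_starts_condSecondMoment` — **if `Q₂(a,n) ≥ c` for all `a ≥ n ≥ 1` then `Crossing.CondBlockGluingAt p c`**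
  (the joint event `B ∩ {translated cube crossed}` has probability `≤ P(B)`);
* `hardCrossingLowerBound_of_cube_and_starts_condSecondMoment` — at `p_c(ℤ³)`: the cube (`CrossingLowerBound cubeShape 0`, OPEN) and
  `Q₂ ≥ c > 0` uniformly (OPEN; census Q22/R22e reads `ζ = Q₂/g`) give `HardCrossingLowerBound K` for every `K ≥ 1`.

So the census column `Q₂` is a kernel LOWER BOUND for the conditional gluing constant: `g(a,n) ≥ Q₂(a,n)` cell by cell (theorem
control R22e), sharper than the relative-Harris-margin route of gen 3 (`condGluing_of_harrisMargin` certifies `η/(1+η)`).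
[cite: LyonsPeres2016, §5.3 Prop. 5.11] [cite: Kesten1982, §3.3 Comment (v)] [cite: GrimmettPercolation1999, §11.7]
-/

noncomputable section

namespace Summit.CriticalPhenomena.PercolationContinuityZ3.Theorems.Crossing

open MeasureTheory Literature.Probability.LatticeModels Literature.Probability.Percolation SimpleGraph
open Summit.CriticalPhenomena.PercolationContinuityZ3.Theorems.SurfaceTension

/-- **`E[M] ≤ E[M²]` for the successful-starts count**: the first-moment sum is dominated by the diagonal of the pair sum
(`𝓛_v ∩ 𝓛_v = 𝓛_v`, `𝓕_v ∩ 𝓕_v = 𝓕_v`; all terms nonnegative). [folklore] -/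
theorem sum_landing_forward_le_pair_sum (p : unitInterval) (n a A : ℕ) :
    ∑ v ∈ (Finset.Icc (0 : Site 3) ![(a : ℤ), n, n]).filter (fun y => y 0 = (a : ℤ)),
        (bondPercolation (zdGraph 3) p).real
            (linked (↑(Finset.Icc (0 : Site 3) ![(a : ℤ), n, n]) : Set (Site 3))
              {y : Site 3 | y ∈ Finset.Icc (0 : Site 3) ![(a : ℤ), n, n] ∧ y 0 = 0} {v}) *
          (bondPercolation (zdGraph 3) p).real
            (linked (insert v {y : Site 3 | y ∈ Finset.Icc (0 : Site 3) ![(A : ℤ), n, n] ∧ (a : ℤ) + 1 ≤ y 0}) {v}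
              {y : Site 3 | y ∈ Finset.Icc (0 : Site 3) ![(A : ℤ), n, n] ∧ y 0 = (A : ℤ)}) ≤
      ∑ v ∈ (Finset.Icc (0 : Site 3) ![(a : ℤ), n, n]).filter (fun y => y 0 = (a : ℤ)),
        ∑ w ∈ (Finset.Icc (0 : Site 3) ![(a : ℤ), n, n]).filter (fun y => y 0 = (a : ℤ)),
          (bondPercolation (zdGraph 3) p).real
              (linked (↑(Finset.Icc (0 : Site 3) ![(a : ℤ), n, n]) : Set (Site 3))
                  {y : Site 3 | y ∈ Finset.Icc (0 : Site 3) ![(a : ℤ), n, n] ∧ y 0 = 0} {v} ∩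
                linked (↑(Finset.Icc (0 : Site 3) ![(a : ℤ), n, n]) : Set (Site 3))
                  {y : Site 3 | y ∈ Finset.Icc (0 : Site 3) ![(a : ℤ), n, n] ∧ y 0 = 0} {w}) *
            (bondPercolation (zdGraph 3) p).real
              (linked (insert v {y : Site 3 | y ∈ Finset.Icc (0 : Site 3) ![(A : ℤ), n, n] ∧ (a : ℤ) + 1 ≤ y 0}) {v}
                  {y : Site 3 | y ∈ Finset.Icc (0 : Site 3) ![(A : ℤ), n, n] ∧ y 0 = (A : ℤ)} ∩
                linked (insert w {y : Site 3 | y ∈ Finset.Icc (0 : Site 3) ![(A : ℤ), n, n] ∧ (a : ℤ) + 1 ≤ y 0}) {w}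
                  {y : Site 3 | y ∈ Finset.Icc (0 : Site 3) ![(A : ℤ), n, n] ∧ y 0 = (A : ℤ)}) := by
  classical
  refine Finset.sum_le_sum fun v hv => ?_
  have hdiag := Finset.single_le_sum (s := (Finset.Icc (0 : Site 3) ![(a : ℤ), n, n]).filter (fun y => y 0 = (a : ℤ)))
    (f := fun w =>
      (bondPercolation (zdGraph 3) p).real
          (linked (↑(Finset.Icc (0 : Site 3) ![(a : ℤ), n, n]) : Set (Site 3))
              {y : Site 3 | y ∈ Finset.Icc (0 : Site 3) ![(a : ℤ), n, n] ∧ y 0 = 0} {v} ∩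
            linked (↑(Finset.Icc (0 : Site 3) ![(a : ℤ), n, n]) : Set (Site 3))
              {y : Site 3 | y ∈ Finset.Icc (0 : Site 3) ![(a : ℤ), n, n] ∧ y 0 = 0} {w}) *
        (bondPercolation (zdGraph 3) p).real
          (linked (insert v {y : Site 3 | y ∈ Finset.Icc (0 : Site 3) ![(A : ℤ), n, n] ∧ (a : ℤ) + 1 ≤ y 0}) {v}
              {y : Site 3 | y ∈ Finset.Icc (0 : Site 3) ![(A : ℤ), n, n] ∧ y 0 = (A : ℤ)} ∩
            linked (insert w {y : Site 3 | y ∈ Finset.Icc (0 : Site 3) ![(A : ℤ), n, n] ∧ (a : ℤ) + 1 ≤ y 0}) {w}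
              {y : Site 3 | y ∈ Finset.Icc (0 : Site 3) ![(A : ℤ), n, n] ∧ y 0 = (A : ℤ)}))
    (fun w _ => mul_nonneg measureReal_nonneg measureReal_nonneg) hv
  simp only [Set.inter_self] at hdiag
  exact hdiag

/-- **The conditional second-moment bound gives the gluing ratio** (every `p`, `a ≤ A`): if the first moment `m = Σ_v ℓ_v f_v`
of successful starts is positive and `c·P_p(boxCross ![a,n,n] 0)·S ≤ m²` for the pair sum `S` (i.e. `Q₂ ≥ c`), then
**`c · P_p(boxCross ![a,n,n] 0) ≤ P_p(boxCross ![A,n,n] 0)`**. [cite: LyonsPeres2016, §5.3 Prop. 5.11] -/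
theorem mul_real_boxCross_le_union_of_condSecondMoment (p : unitInterval) {n a A : ℕ} (haA : a ≤ A) {c : ℝ}
    (hpos : 0 < ∑ v ∈ (Finset.Icc (0 : Site 3) ![(a : ℤ), n, n]).filter (fun y => y 0 = (a : ℤ)),
        (bondPercolation (zdGraph 3) p).real
            (linked (↑(Finset.Icc (0 : Site 3) ![(a : ℤ), n, n]) : Set (Site 3))
              {y : Site 3 | y ∈ Finset.Icc (0 : Site 3) ![(a : ℤ), n, n] ∧ y 0 = 0} {v}) *
          (bondPercolation (zdGraph 3) p).real
            (linked (insert v {y : Site 3 | y ∈ Finset.Icc (0 : Site 3) ![(A : ℤ), n, n] ∧ (a : ℤ) + 1 ≤ y 0}) {v}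
              {y : Site 3 | y ∈ Finset.Icc (0 : Site 3) ![(A : ℤ), n, n] ∧ y 0 = (A : ℤ)}))
    (h2 : c * (bondPercolation (zdGraph 3) p).real (boxCross (![(a : ℤ), n, n] : Site 3) 0) *
        (∑ v ∈ (Finset.Icc (0 : Site 3) ![(a : ℤ), n, n]).filter (fun y => y 0 = (a : ℤ)),
          ∑ w ∈ (Finset.Icc (0 : Site 3) ![(a : ℤ), n, n]).filter (fun y => y 0 = (a : ℤ)),
            (bondPercolation (zdGraph 3) p).real
                (linked (↑(Finset.Icc (0 : Site 3) ![(a : ℤ), n, n]) : Set (Site 3))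
                    {y : Site 3 | y ∈ Finset.Icc (0 : Site 3) ![(a : ℤ), n, n] ∧ y 0 = 0} {v} ∩
                  linked (↑(Finset.Icc (0 : Site 3) ![(a : ℤ), n, n]) : Set (Site 3))
                    {y : Site 3 | y ∈ Finset.Icc (0 : Site 3) ![(a : ℤ), n, n] ∧ y 0 = 0} {w}) *
              (bondPercolation (zdGraph 3) p).real
                (linked (insert v {y : Site 3 | y ∈ Finset.Icc (0 : Site 3) ![(A : ℤ), n, n] ∧ (a : ℤ) + 1 ≤ y 0}) {v}
                    {y : Site 3 | y ∈ Finset.Icc (0 : Site 3) ![(A : ℤ), n, n] ∧ y 0 = (A : ℤ)} ∩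
                  linked (insert w {y : Site 3 | y ∈ Finset.Icc (0 : Site 3) ![(A : ℤ), n, n] ∧ (a : ℤ) + 1 ≤ y 0}) {w}
                    {y : Site 3 | y ∈ Finset.Icc (0 : Site 3) ![(A : ℤ), n, n] ∧ y 0 = (A : ℤ)})) ≤
      (∑ v ∈ (Finset.Icc (0 : Site 3) ![(a : ℤ), n, n]).filter (fun y => y 0 = (a : ℤ)),
        (bondPercolation (zdGraph 3) p).real
            (linked (↑(Finset.Icc (0 : Site 3) ![(a : ℤ), n, n]) : Set (Site 3))
              {y : Site 3 | y ∈ Finset.Icc (0 : Site 3) ![(a : ℤ), n, n] ∧ y 0 = 0} {v}) *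
          (bondPercolation (zdGraph 3) p).real
            (linked (insert v {y : Site 3 | y ∈ Finset.Icc (0 : Site 3) ![(A : ℤ), n, n] ∧ (a : ℤ) + 1 ≤ y 0}) {v}
              {y : Site 3 | y ∈ Finset.Icc (0 : Site 3) ![(A : ℤ), n, n] ∧ y 0 = (A : ℤ)})) ^ 2) :
    c * (bondPercolation (zdGraph 3) p).real (boxCross (![(a : ℤ), n, n] : Site 3) 0) ≤
      (bondPercolation (zdGraph 3) p).real (boxCross (![(A : ℤ), n, n] : Site 3) 0) := by
  have hsand := sq_sum_landing_forward_le p haA (n := n)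
  have hmS := sum_landing_forward_le_pair_sum p n a A
  -- abbreviate: m = first moment, S = pair sum
  set m := ∑ v ∈ (Finset.Icc (0 : Site 3) ![(a : ℤ), n, n]).filter (fun y => y 0 = (a : ℤ)),
        (bondPercolation (zdGraph 3) p).real
            (linked (↑(Finset.Icc (0 : Site 3) ![(a : ℤ), n, n]) : Set (Site 3))
              {y : Site 3 | y ∈ Finset.Icc (0 : Site 3) ![(a : ℤ), n, n] ∧ y 0 = 0} {v}) *
          (bondPercolation (zdGraph 3) p).real
            (linked (insert v {y : Site 3 | y ∈ Finset.Icc (0 : Site 3) ![(A : ℤ), n, n] ∧ (a : ℤ) + 1 ≤ y 0}) {v}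
              {y : Site 3 | y ∈ Finset.Icc (0 : Site 3) ![(A : ℤ), n, n] ∧ y 0 = (A : ℤ)}) with hm
  set S := ∑ v ∈ (Finset.Icc (0 : Site 3) ![(a : ℤ), n, n]).filter (fun y => y 0 = (a : ℤ)),
          ∑ w ∈ (Finset.Icc (0 : Site 3) ![(a : ℤ), n, n]).filter (fun y => y 0 = (a : ℤ)),
            (bondPercolation (zdGraph 3) p).real
                (linked (↑(Finset.Icc (0 : Site 3) ![(a : ℤ), n, n]) : Set (Site 3))
                    {y : Site 3 | y ∈ Finset.Icc (0 : Site 3) ![(a : ℤ), n, n] ∧ y 0 = 0} {v} ∩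
                  linked (↑(Finset.Icc (0 : Site 3) ![(a : ℤ), n, n]) : Set (Site 3))
                    {y : Site 3 | y ∈ Finset.Icc (0 : Site 3) ![(a : ℤ), n, n] ∧ y 0 = 0} {w}) *
              (bondPercolation (zdGraph 3) p).real
                (linked (insert v {y : Site 3 | y ∈ Finset.Icc (0 : Site 3) ![(A : ℤ), n, n] ∧ (a : ℤ) + 1 ≤ y 0}) {v}
                    {y : Site 3 | y ∈ Finset.Icc (0 : Site 3) ![(A : ℤ), n, n] ∧ y 0 = (A : ℤ)} ∩
                  linked (insert w {y : Site 3 | y ∈ Finset.Icc (0 : Site 3) ![(A : ℤ), n, n] ∧ (a : ℤ) + 1 ≤ y 0}) {w}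
                    {y : Site 3 | y ∈ Finset.Icc (0 : Site 3) ![(A : ℤ), n, n] ∧ y 0 = (A : ℤ)}) with hS
  have hSpos : 0 < S := lt_of_lt_of_le hpos hmS
  -- c·P(B)·S ≤ m² ≤ P(U)·S, cancel S > 0
  have key : c * (bondPercolation (zdGraph 3) p).real (boxCross (![(a : ℤ), n, n] : Site 3) 0) * S ≤
      (bondPercolation (zdGraph 3) p).real (boxCross (![(A : ℤ), n, n] : Site 3) 0) * S := h2.trans hsand
  exact le_of_mul_le_mul_right key hSpos

/-- **`Q₂ ≥ c` uniformly ⇒ `CondBlockGluingAt p c`.**  If for all `a ≥ n ≥ 1`, with the slab thickness `n − ⌊n/2⌋` of the lane's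
conditional block gluing, the successful starts have positive first moment `m` and `c·P_p(boxCross ![a,n,n] 0)·S ≤ m²`
(`Q₂(a,n) ≥ c`), then `c · P_p(block ∧ translated cube crossed) ≤ P_p(union crossed)` — the typed gen-3 node
`Crossing.CondBlockGluingAt p c` — because the joint event has probability at most `P_p(boxCross ![a,n,n] 0)`.
[cite: Kesten1982, §3.3 Comment (v)] [cite: LyonsPeres2016, §5.3 Prop. 5.11] -/
theorem condBlockGluingAt_of_starts_condSecondMoment (p : unitInterval) {c : ℝ} (hc : 0 ≤ c)
    (h : ∀ n : ℕ, 1 ≤ n → ∀ a : ℕ, n ≤ a →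
      0 < ∑ v ∈ (Finset.Icc (0 : Site 3) ![(a : ℤ), n, n]).filter (fun y => y 0 = (a : ℤ)),
          (bondPercolation (zdGraph 3) p).real
              (linked (↑(Finset.Icc (0 : Site 3) ![(a : ℤ), n, n]) : Set (Site 3))
                {y : Site 3 | y ∈ Finset.Icc (0 : Site 3) ![(a : ℤ), n, n] ∧ y 0 = 0} {v}) *
            (bondPercolation (zdGraph 3) p).real
              (linked (insert v {y : Site 3 | y ∈ Finset.Icc (0 : Site 3) ![((a + n - n / 2 : ℕ) : ℤ), n, n] ∧
                  (a : ℤ) + 1 ≤ y 0}) {v}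
                {y : Site 3 | y ∈ Finset.Icc (0 : Site 3) ![((a + n - n / 2 : ℕ) : ℤ), n, n] ∧
                  y 0 = ((a + n - n / 2 : ℕ) : ℤ)}) ∧
      c * (bondPercolation (zdGraph 3) p).real (boxCross (![(a : ℤ), n, n] : Site 3) 0) *
          (∑ v ∈ (Finset.Icc (0 : Site 3) ![(a : ℤ), n, n]).filter (fun y => y 0 = (a : ℤ)),
            ∑ w ∈ (Finset.Icc (0 : Site 3) ![(a : ℤ), n, n]).filter (fun y => y 0 = (a : ℤ)),
              (bondPercolation (zdGraph 3) p).real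
                  (linked (↑(Finset.Icc (0 : Site 3) ![(a : ℤ), n, n]) : Set (Site 3))
                      {y : Site 3 | y ∈ Finset.Icc (0 : Site 3) ![(a : ℤ), n, n] ∧ y 0 = 0} {v} ∩
                    linked (↑(Finset.Icc (0 : Site 3) ![(a : ℤ), n, n]) : Set (Site 3))
                      {y : Site 3 | y ∈ Finset.Icc (0 : Site 3) ![(a : ℤ), n, n] ∧ y 0 = 0} {w}) *
                (bondPercolation (zdGraph 3) p).real
                  (linked (insert v {y : Site 3 | y ∈ Finset.Icc (0 : Site 3) ![((a + n - n / 2 : ℕ) : ℤ), n, n] ∧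
                        (a : ℤ) + 1 ≤ y 0}) {v}
                      {y : Site 3 | y ∈ Finset.Icc (0 : Site 3) ![((a + n - n / 2 : ℕ) : ℤ), n, n] ∧
                        y 0 = ((a + n - n / 2 : ℕ) : ℤ)} ∩
                    linked (insert w {y : Site 3 | y ∈ Finset.Icc (0 : Site 3) ![((a + n - n / 2 : ℕ) : ℤ), n, n] ∧
                        (a : ℤ) + 1 ≤ y 0}) {w}
                      {y : Site 3 | y ∈ Finset.Icc (0 : Site 3) ![((a + n - n / 2 : ℕ) : ℤ), n, n] ∧
                        y 0 = ((a + n - n / 2 : ℕ) : ℤ)})) ≤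
        (∑ v ∈ (Finset.Icc (0 : Site 3) ![(a : ℤ), n, n]).filter (fun y => y 0 = (a : ℤ)),
          (bondPercolation (zdGraph 3) p).real
              (linked (↑(Finset.Icc (0 : Site 3) ![(a : ℤ), n, n]) : Set (Site 3))
                {y : Site 3 | y ∈ Finset.Icc (0 : Site 3) ![(a : ℤ), n, n] ∧ y 0 = 0} {v}) *
            (bondPercolation (zdGraph 3) p).real
              (linked (insert v {y : Site 3 | y ∈ Finset.Icc (0 : Site 3) ![((a + n - n / 2 : ℕ) : ℤ), n, n] ∧
                  (a : ℤ) + 1 ≤ y 0}) {v}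
                {y : Site 3 | y ∈ Finset.Icc (0 : Site 3) ![((a + n - n / 2 : ℕ) : ℤ), n, n] ∧
                  y 0 = ((a + n - n / 2 : ℕ) : ℤ)})) ^ 2) :
    CondBlockGluingAt p c := by
  intro n hn a ha
  obtain ⟨hpos, h2⟩ := h n hn a ha
  have haA : a ≤ a + n - n / 2 := by have := Nat.div_le_self n 2; omega
  have hU := mul_real_boxCross_le_union_of_condSecondMoment p haA hpos h2
  refine le_trans (mul_le_mul_of_nonneg_left ?_ hc) hU
  exact measureReal_mono Set.inter_subset_left (measure_ne_top _ _)

/-- **At `p_c(ℤ³)`: the cube and a uniform conditional second-moment bound give hard-direction RSW at every aspect** —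
`CrossingLowerBound cubeShape 0` (OPEN) and `Q₂(a,n) ≥ c > 0` for all `a ≥ n ≥ 1` (OPEN; census Q22/R22e) imply
`HardCrossingLowerBound K` for every `K ≥ 1` (via `CondBlockGluing` and `hardCrossingLowerBound_of_cube_and_condBlockGluing`).
[cite: Kesten1982, §3.3 Comment (v)] [cite: LyonsPeres2016, §5.3 Prop. 5.11] -/
theorem hardCrossingLowerBound_of_cube_and_starts_condSecondMoment (hcube : CrossingLowerBound cubeShape 0) {c : ℝ}
    (hc : 0 < c)
    (h : ∀ n : ℕ, 1 ≤ n → ∀ a : ℕ, n ≤ a →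
      0 < ∑ v ∈ (Finset.Icc (0 : Site 3) ![(a : ℤ), n, n]).filter (fun y => y 0 = (a : ℤ)),
          (bondPercolation (zdGraph 3) (criticalProbI 3)).real
              (linked (↑(Finset.Icc (0 : Site 3) ![(a : ℤ), n, n]) : Set (Site 3))
                {y : Site 3 | y ∈ Finset.Icc (0 : Site 3) ![(a : ℤ), n, n] ∧ y 0 = 0} {v}) *
            (bondPercolation (zdGraph 3) (criticalProbI 3)).real
              (linked (insert v {y : Site 3 | y ∈ Finset.Icc (0 : Site 3) ![((a + n - n / 2 : ℕ) : ℤ), n, n] ∧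
                  (a : ℤ) + 1 ≤ y 0}) {v}
                {y : Site 3 | y ∈ Finset.Icc (0 : Site 3) ![((a + n - n / 2 : ℕ) : ℤ), n, n] ∧
                  y 0 = ((a + n - n / 2 : ℕ) : ℤ)}) ∧
      c * (bondPercolation (zdGraph 3) (criticalProbI 3)).real (boxCross (![(a : ℤ), n, n] : Site 3) 0) *
          (∑ v ∈ (Finset.Icc (0 : Site 3) ![(a : ℤ), n, n]).filter (fun y => y 0 = (a : ℤ)),
            ∑ w ∈ (Finset.Icc (0 : Site 3) ![(a : ℤ), n, n]).filter (fun y => y 0 = (a : ℤ)),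
              (bondPercolation (zdGraph 3) (criticalProbI 3)).real
                  (linked (↑(Finset.Icc (0 : Site 3) ![(a : ℤ), n, n]) : Set (Site 3))
                      {y : Site 3 | y ∈ Finset.Icc (0 : Site 3) ![(a : ℤ), n, n] ∧ y 0 = 0} {v} ∩
                    linked (↑(Finset.Icc (0 : Site 3) ![(a : ℤ), n, n]) : Set (Site 3))
                      {y : Site 3 | y ∈ Finset.Icc (0 : Site 3) ![(a : ℤ), n, n] ∧ y 0 = 0} {w}) *
                (bondPercolation (zdGraph 3) (criticalProbI 3)).real
                  (linked (insert v {y : Site 3 | y ∈ Finset.Icc (0 : Site 3) ![((a + n - n / 2 : ℕ) : ℤ), n, n] ∧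
                        (a : ℤ) + 1 ≤ y 0}) {v}
                      {y : Site 3 | y ∈ Finset.Icc (0 : Site 3) ![((a + n - n / 2 : ℕ) : ℤ), n, n] ∧
                        y 0 = ((a + n - n / 2 : ℕ) : ℤ)} ∩
                    linked (insert w {y : Site 3 | y ∈ Finset.Icc (0 : Site 3) ![((a + n - n / 2 : ℕ) : ℤ), n, n] ∧
                        (a : ℤ) + 1 ≤ y 0}) {w}
                      {y : Site 3 | y ∈ Finset.Icc (0 : Site 3) ![((a + n - n / 2 : ℕ) : ℤ), n, n] ∧
                        y 0 = ((a + n - n / 2 : ℕ) : ℤ)})) ≤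
        (∑ v ∈ (Finset.Icc (0 : Site 3) ![(a : ℤ), n, n]).filter (fun y => y 0 = (a : ℤ)),
          (bondPercolation (zdGraph 3) (criticalProbI 3)).real
              (linked (↑(Finset.Icc (0 : Site 3) ![(a : ℤ), n, n]) : Set (Site 3))
                {y : Site 3 | y ∈ Finset.Icc (0 : Site 3) ![(a : ℤ), n, n] ∧ y 0 = 0} {v}) *
            (bondPercolation (zdGraph 3) (criticalProbI 3)).real
              (linked (insert v {y : Site 3 | y ∈ Finset.Icc (0 : Site 3) ![((a + n - n / 2 : ℕ) : ℤ), n, n] ∧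
                  (a : ℤ) + 1 ≤ y 0}) {v}
                {y : Site 3 | y ∈ Finset.Icc (0 : Site 3) ![((a + n - n / 2 : ℕ) : ℤ), n, n] ∧
                  y 0 = ((a + n - n / 2 : ℕ) : ℤ)})) ^ 2)
    {K : ℕ} (hK : 1 ≤ K) : HardCrossingLowerBound K :=
  hardCrossingLowerBound_of_cube_and_condBlockGluing hcube
    ⟨c, hc, condBlockGluingAt_of_starts_condSecondMoment (criticalProbI 3) hc.le h⟩ hK

end Summit.CriticalPhenomena.PercolationContinuityZ3.Theorems.Crossing

end
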